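import Mathlib.Analysis.InnerProductSpace.Calculus
import Mathlib.Analysis.Calculus.Deriv.MeanValue
import Mathlib.Analysis.SpecialFunctions.ExpDeriv
import HarnessLib

/-!
# K1L_D `stub_D1_V0thg` (stmt-AnomalousDissipation-27980), R3′ lane «SidebandTailCrushing» (tenure D28-16 (3)) — file F1:
# an ABSTRACT three-term hypocoercivity lemma (finite- or infinite-dimensional real inner-product space; Mathlib only)

Helper file of route `SolenoidalFractalHomogenisation` (prover seat `ad-k1l-cellLawV-w1` g10; plan memo
`Cruxes/LagrangianRenormalisationStepDesign/Lines/onelevel-vtheta-R3-plan.md` §4; `--supports stmt-AnomalousDissipation-27980 --as helper`).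

SETTING.  A real inner-product space `F`, a subspace `V`, bounded operators `K` (symmetric, "site index"), `B` (skew, "hopping"),
`C := [K,B]` (then symmetric, "bond operator"), a family `D t` of symmetric positive-semidefinite operators commuting with `K` ("damping"), a scalar
amplitude `G t ∈ [Gm, GM]`, `Gm ≥ 0`, and a curve `y` with `y t ∈ V` solving `y′ = G(t)•B y − D(t) y` on `[t₀,t₁]`.  Quantitative hypotheses on `V`
(constants `lo₁, CJ, A, η, U₁, U₂, U₃`): `lo₁‖Ku‖² ≤ ⟪Du,u⟫`, `⟪D(Cu),Cu⟫ ≤ CJ⟪Du,u⟫`, `‖Cu‖² ≤ A‖u‖²`, the SIGNED-COMMUTATOR allowance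
`⟪Ku,[C,B]u⟫ ≥ −η⟪Du,u⟫`, and the COERCIVITY ("uncertainty") inequality `‖u‖² ≤ U₁‖Cu‖² + U₂‖Ku‖² + U₃⟪Du,u⟫`.

RESULT (`hypocoercive_decay`).  For parameters `α, β, λ > 0`-ish satisfying eight polynomial constraints (P1)–(P8) the functional
`Φ = ‖y‖² + α‖Ky‖² − 2β⟪Ky,Cy⟫` obeys `Φ′ ≤ −λΦ`, `½(‖y‖²+α‖Ky‖²) ≤ Φ ≤ 3/2(‖y‖²+α‖Ky‖²)`, hence
`‖y t₁‖² ≤ 3·e^{−λ(t₁−t₀)}·(‖y t₀‖² + α‖K(y t₀)‖²)`.  This is the time-domain hypocoercivity scheme of Bedrossian–Coti Zelati (shear flows,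
functional `‖f‖² + α‖∂_y f‖² + β⟨iku′f, ∂_y f⟩ + γ‖ku′f‖²`) with the LAST TERM DROPPED (we only need some algebraic rate: exponent 1/3 instead of 1/2),
transplanted to the operator language of Villani's `A*A + B` framework; the proof is Young's inequality for the form `⟪D·,·⟫`, the commutator identities,
and `t ↦ e^{λt}Φ(t)` antitone (`antitoneOn_of_deriv_nonpos`).  Everything is elementary and sorry-free; no definition, no named fact.  NOT a proof of `stub_D1_V0thg`, of K1L_D or of AD; rung F-D1.A0 infrastructure.  The ladder instance (K = half-integer site
index along an `mᵢ`-ladder of `Sideband.box`, B = the slot's link operator, D = `4π²P_zT_{𝔸ᵀ}(z)P_z`) is file F4 of the memo.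
-/

set_option linter.dupNamespace false -- single-conjunct summit: `Summit.AnomalousDissipation.AnomalousDissipation.…` is the mandated namespace

namespace Summit.AnomalousDissipation.AnomalousDissipation.Theorems.SolenoidalFractalHomogenisation.LagrangianStep.LadderCrush

open Set
open scoped InnerProductSpace

noncomputable section

variable {F : Type*} [NormedAddCommGroup F] [InnerProductSpace ℝ F]

/-! ## §1 Young's inequality for a symmetric positive-semidefinite form -/

/-- **Young's inequality for the form `⟪D·,·⟫`**: `D` symmetric and `⟪Du,u⟫ ≥ 0` give `2⟪Du,v⟫ ≤ ε⟪Du,u⟫ + ε⁻¹⟪Dv,v⟫` for every `ε > 0`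
(expand `0 ≤ ⟪D(εu − v), εu − v⟫`). [cite: Villani2009, Part I §2 (A*A + B framework: elementary inequalities)] -/
theorem young_form (D : F →L[ℝ] F) (hs : ∀ u v, ⟪D u, v⟫_ℝ = ⟪u, D v⟫_ℝ) (hp : ∀ u, 0 ≤ ⟪D u, u⟫_ℝ)
    {ε : ℝ} (hε : 0 < ε) (u v : F) :
    2 * ⟪D u, v⟫_ℝ ≤ ε * ⟪D u, u⟫_ℝ + ε⁻¹ * ⟪D v, v⟫_ℝ := by
  have h0 := hp (ε • u - v)
  have hvu : ⟪D v, u⟫_ℝ = ⟪D u, v⟫_ℝ := by rw [hs v u, real_inner_comm]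
  rw [map_sub, map_smul, inner_sub_left, inner_sub_right, inner_sub_right, real_inner_smul_left, real_inner_smul_left,
    real_inner_smul_right, real_inner_smul_right, hvu] at h0
  -- h0 : 0 ≤ ε * (ε * ⟪D u, u⟫) - ε * ⟪D u, v⟫ - (ε * ⟪D u, v⟫ - ⟪D v, v⟫)
  have h1 : 2 * (ε * ⟪D u, v⟫_ℝ) ≤ ε * (ε * ⟪D u, u⟫_ℝ) + ⟪D v, v⟫_ℝ := by linarith
  have h2 : 2 * ⟪D u, v⟫_ℝ ≤ ε * ⟪D u, u⟫_ℝ + ε⁻¹ * ⟪D v, v⟫_ℝ := by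
    have := mul_le_mul_of_nonneg_left h1 (inv_pos.mpr hε).le
    have e1 : ε⁻¹ * (2 * (ε * ⟪D u, v⟫_ℝ)) = 2 * ⟪D u, v⟫_ℝ := by field_simp
    have e2 : ε⁻¹ * (ε * (ε * ⟪D u, u⟫_ℝ) + ⟪D v, v⟫_ℝ) = ε * ⟪D u, u⟫_ℝ + ε⁻¹ * ⟪D v, v⟫_ℝ := by field_simp
    rw [e1, e2] at this
    exact this
  exact h2

/-- Two-sided form of `young_form`: `2|⟪Du,v⟫| ≤ ε⟪Du,u⟫ + ε⁻¹⟪Dv,v⟫`. [cite: Villani2009, Part I §2] -/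
theorem young_form_abs (D : F →L[ℝ] F) (hs : ∀ u v, ⟪D u, v⟫_ℝ = ⟪u, D v⟫_ℝ) (hp : ∀ u, 0 ≤ ⟪D u, u⟫_ℝ)
    {ε : ℝ} (hε : 0 < ε) (u v : F) :
    2 * |⟪D u, v⟫_ℝ| ≤ ε * ⟪D u, u⟫_ℝ + ε⁻¹ * ⟪D v, v⟫_ℝ := by
  rcases le_or_gt 0 ⟪D u, v⟫_ℝ with h | h
  · rw [abs_of_nonneg h]; exact young_form D hs hp hε u v
  · rw [abs_of_neg h]
    have := young_form D hs hp hε u (-v)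
    rw [inner_neg_right, map_neg, inner_neg_left, inner_neg_right, neg_neg] at this
    linarith

/-! ## §2 Algebra of the commutator `C = [K,B]` -/

/-- `C = [K,B]` with `K` symmetric and `B` skew is symmetric. [cite: Villani2009, Part I §2] -/
theorem comm_symm (K B C : F →L[ℝ] F) (hK : ∀ u v, ⟪K u, v⟫_ℝ = ⟪u, K v⟫_ℝ) (hB : ∀ u v, ⟪B u, v⟫_ℝ = -⟪u, B v⟫_ℝ)
    (hC : ∀ u, C u = K (B u) - B (K u)) (u v : F) : ⟪C u, v⟫_ℝ = ⟪u, C v⟫_ℝ := by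
  have e1 : ⟪K (B u), v⟫_ℝ = -⟪u, B (K v)⟫_ℝ := by rw [hK, hB]
  have e2 : ⟪B (K u), v⟫_ℝ = -⟪u, K (B v)⟫_ℝ := by rw [hB, hK]
  rw [hC u, hC v, inner_sub_left, inner_sub_right, e1, e2]
  ring

/-- A skew operator has `⟪Bu,u⟫ = 0`. [cite: Villani2009, Part I §2] -/
theorem skew_inner_self (B : F →L[ℝ] F) (hB : ∀ u v, ⟪B u, v⟫_ℝ = -⟪u, B v⟫_ℝ) (u : F) : ⟪B u, u⟫_ℝ = 0 := by
  have h := hB u u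
  rw [real_inner_comm (B u) u] at h
  -- h : ⟪B u, u⟫ = -⟪B u, u⟫  (after comm both sides are the same number)
  linarith

/-! ## §3 The functional and its two-sided equivalence -/

/-- The cross term is dominated: `2β|⟪Ku,Cu⟫| ≤ (α/2)‖Ku‖² + ½‖u‖²` when `‖Cu‖² ≤ A‖u‖²` and `4Aβ² ≤ α`, `α > 0`.
[cite: BedrossianCotiZelati2017, §2] -/
theorem cross_le (K C : F →L[ℝ] F) {α β A : ℝ} (hα : 0 < α) (hβ : 0 ≤ β) (P1 : 4 * A * β ^ 2 ≤ α) (u : F)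
    (h3 : ‖C u‖ ^ 2 ≤ A * ‖u‖ ^ 2) : 2 * β * |⟪K u, C u⟫_ℝ| ≤ α / 2 * ‖K u‖ ^ 2 + 1 / 2 * ‖u‖ ^ 2 := by
  have hkc : |⟪K u, C u⟫_ℝ| ≤ ‖K u‖ * ‖C u‖ := abs_real_inner_le_norm _ _
  have hk : 0 ≤ ‖K u‖ := norm_nonneg _
  have hc : 0 ≤ ‖C u‖ := norm_nonneg _
  -- 2β‖Ku‖‖Cu‖ ≤ (α/2)‖Ku‖² + (2β²/α)‖Cu‖²
  have h1 : 2 * β * (‖K u‖ * ‖C u‖) ≤ α / 2 * ‖K u‖ ^ 2 + 2 * β ^ 2 / α * ‖C u‖ ^ 2 := by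
    have h : 0 ≤ (α * ‖K u‖ - 2 * β * ‖C u‖) ^ 2 := sq_nonneg _
    have e : α / 2 * ‖K u‖ ^ 2 + 2 * β ^ 2 / α * ‖C u‖ ^ 2 - 2 * β * (‖K u‖ * ‖C u‖)
        = (α * ‖K u‖ - 2 * β * ‖C u‖) ^ 2 / (2 * α) := by field_simp; ring
    have : 0 ≤ (α * ‖K u‖ - 2 * β * ‖C u‖) ^ 2 / (2 * α) := div_nonneg h (by linarith)
    linarith
  have h2 : 2 * β ^ 2 / α * ‖C u‖ ^ 2 ≤ 1 / 2 * ‖u‖ ^ 2 := by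
    have : 2 * β ^ 2 / α * ‖C u‖ ^ 2 ≤ 2 * β ^ 2 / α * (A * ‖u‖ ^ 2) :=
      mul_le_mul_of_nonneg_left h3 (by positivity)
    have hcoef : 2 * β ^ 2 / α * A ≤ 1 / 2 := by
      rw [div_mul_eq_mul_div, div_le_iff₀ hα]; linarith
    nlinarith [sq_nonneg ‖u‖]
  calc 2 * β * |⟪K u, C u⟫_ℝ| ≤ 2 * β * (‖K u‖ * ‖C u‖) := mul_le_mul_of_nonneg_left hkc (by linarith)
    _ ≤ _ := by linarith

/-- **Lower equivalence** `½(‖u‖² + α‖Ku‖²) ≤ Φ(u) := ‖u‖² + α‖Ku‖² − 2β⟪Ku,Cu⟫`. [cite: BedrossianCotiZelati2017, §2] -/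
theorem functional_ge (K C : F →L[ℝ] F) {α β A : ℝ} (hα : 0 < α) (hβ : 0 ≤ β) (P1 : 4 * A * β ^ 2 ≤ α) (u : F)
    (h3 : ‖C u‖ ^ 2 ≤ A * ‖u‖ ^ 2) : 1 / 2 * (‖u‖ ^ 2 + α * ‖K u‖ ^ 2) ≤ ‖u‖ ^ 2 + α * ‖K u‖ ^ 2 - 2 * β * ⟪K u, C u⟫_ℝ := by
  have h := cross_le K C hα hβ P1 u h3
  have habs : 2 * β * ⟪K u, C u⟫_ℝ ≤ 2 * β * |⟪K u, C u⟫_ℝ| := mul_le_mul_of_nonneg_left (le_abs_self _) (by linarith)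
  linarith

/-- **Upper equivalence** `Φ(u) ≤ 3/2(‖u‖² + α‖Ku‖²)`. [cite: BedrossianCotiZelati2017, §2] -/
theorem functional_le (K C : F →L[ℝ] F) {α β A : ℝ} (hα : 0 < α) (hβ : 0 ≤ β) (P1 : 4 * A * β ^ 2 ≤ α) (u : F)
    (h3 : ‖C u‖ ^ 2 ≤ A * ‖u‖ ^ 2) : ‖u‖ ^ 2 + α * ‖K u‖ ^ 2 - 2 * β * ⟪K u, C u⟫_ℝ ≤ 3 / 2 * (‖u‖ ^ 2 + α * ‖K u‖ ^ 2) := by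
  have h := cross_le K C hα hβ P1 u h3
  have habs : -(2 * β * ⟪K u, C u⟫_ℝ) ≤ 2 * β * |⟪K u, C u⟫_ℝ| := by
    have := mul_le_mul_of_nonneg_left (neg_le_abs ⟪K u, C u⟫_ℝ) (by linarith : (0:ℝ) ≤ 2 * β)
    linarith
  linarith

/-! ## §4 The scalar bookkeeping -/

/-- **Scalar core of the dissipation inequality**: the real-arithmetic combination of the Young bounds, the signed-commutator allowance,
the coercivity inequality and (P1)–(P8).  All variables are real numbers standing for the norms / forms of `dissipation_pointwise`
(`k = ‖Ku‖`, `c = ‖Cu‖`, `n = ‖u‖`, `d0 = ⟪Du,u⟫`, `dK = ⟪DKu,Ku⟫`, `dC = ⟪DCu,Cu⟫`, `dCK = ⟪DCKu,CKu⟫`, `x = ⟪Ku,Cu⟫`,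
`m = ⟪Ku,[C,B]u⟫`, `p = ⟪DKu,Cu⟫`, `q = ⟪Du,CKu⟫`). [cite: BedrossianCotiZelati2017, §2] -/
theorem scalar_core {k c n d0 dK dC dCK x m p q g Gm GM lo₁ CJ A η U₁ U₂ U₃ α β lam : ℝ}
    (hk : 0 ≤ k) (hc : 0 ≤ c) (hd0 : 0 ≤ d0) (hdK : 0 ≤ dK)
    (hGm : 0 ≤ Gm) (hg : Gm ≤ g ∧ g ≤ GM) (hlo₁ : 0 < lo₁) (hCJ : 0 < CJ) (hη : 0 ≤ η) (hα : 0 < α) (hβ : 0 < β) (hlam : 0 ≤ lam)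
    (h1 : lo₁ * k ^ 2 ≤ d0) (h2 : dC ≤ CJ * d0) (h2' : dCK ≤ CJ * dK) (h3 : c ^ 2 ≤ A * n ^ 2) (h4 : -(η * d0) ≤ m)
    (h5 : n ^ 2 ≤ U₁ * c ^ 2 + U₂ * k ^ 2 + U₃ * d0) (hx : |x| ≤ k * c)
    (yq : 2 * q ≤ (2 * β * CJ / α) * d0 + (2 * β * CJ / α)⁻¹ * dCK) (yp : 2 * p ≤ (α / (2 * β)) * dK + (α / (2 * β))⁻¹ * dC)
    (P1 : 4 * A * β ^ 2 ≤ α) (P2 : 8 * CJ * β ^ 2 ≤ α) (P3 : 2 * α ^ 2 * GM ^ 2 ≤ β * Gm * lo₁) (P4 : 8 * β * GM * η ≤ 1)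
    (P5 : 6 * lam * α ≤ lo₁) (P6 : 6 * lam * U₂ ≤ lo₁) (P7 : 6 * lam * U₃ ≤ 1) (P8 : 3 * lam * U₁ ≤ 2 * β * Gm) :
    -2 * d0 + 2 * α * g * x - 2 * α * dK - 2 * β * g * c ^ 2 - 2 * β * g * m + 2 * β * q + 2 * β * p
      ≤ -(lam * (n ^ 2 + α * k ^ 2 - 2 * β * x)) := by
  have hg0 : 0 ≤ g := hGm.trans hg.1
  have hc2 : 0 ≤ c ^ 2 := by positivity
  have hk2 : 0 ≤ k ^ 2 := by positivity
  have hkc : 0 ≤ k * c := mul_nonneg hk hc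
  have hxle : x ≤ k * c := (le_abs_self x).trans hx
  have hxge : -x ≤ k * c := (neg_le_abs x).trans hx
  -- (a) the hopping cross term of `‖Ku‖²`: 2αg x ≤ d0/2 + βGm c²
  have ha : 2 * α * g * x ≤ d0 / 2 + β * Gm * c ^ 2 := by
    have hαg : 0 ≤ 2 * α * g := by positivity
    have step1 : 2 * α * g * x ≤ 2 * α * g * (k * c) := mul_le_mul_of_nonneg_left hxle hαg
    have sq : 2 * (lo₁ * k) * (2 * α * g * c) ≤ (lo₁ * k) ^ 2 + (2 * α * g * c) ^ 2 := two_mul_le_add_sq _ _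
    have step3 : lo₁ * (lo₁ * k ^ 2) ≤ lo₁ * d0 := mul_le_mul_of_nonneg_left h1 hlo₁.le
    have hg2 : g ^ 2 ≤ GM ^ 2 := pow_le_pow_left₀ hg0 hg.2 2
    have t1 : α ^ 2 * g ^ 2 ≤ α ^ 2 * GM ^ 2 := mul_le_mul_of_nonneg_left hg2 (sq_nonneg α)
    have t2 : 4 * α ^ 2 * g ^ 2 ≤ 2 * (β * Gm * lo₁) := by linarith
    have step4 : 4 * α ^ 2 * g ^ 2 * c ^ 2 ≤ 2 * (β * Gm * lo₁) * c ^ 2 := mul_le_mul_of_nonneg_right t2 hc2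
    have step5 : lo₁ * (4 * α * g * (k * c)) ≤ lo₁ * (d0 + 2 * β * Gm * c ^ 2) := by linarith
    have step6 : 4 * α * g * (k * c) ≤ d0 + 2 * β * Gm * c ^ 2 := le_of_mul_le_mul_left step5 hlo₁
    linarith
  -- (b) the main good term
  have hb : 2 * β * Gm * c ^ 2 ≤ 2 * β * g * c ^ 2 := by
    have t := mul_le_mul_of_nonneg_left hg.1 (by positivity : (0:ℝ) ≤ 2 * β * c ^ 2)
    linarith
  -- (c) the signed commutator
  have hc' : -(2 * β * g * m) ≤ d0 / 4 := by
    have hηd : 0 ≤ η * d0 := mul_nonneg hη hd0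
    have h2βg : 0 ≤ 2 * β * g := by positivity
    have t1 : 2 * β * g * (-(η * d0)) ≤ 2 * β * g * m := mul_le_mul_of_nonneg_left h4 h2βg
    have t2' : 2 * β * g ≤ 2 * β * GM := by
      have := mul_le_mul_of_nonneg_left hg.2 (by positivity : (0:ℝ) ≤ 2 * β); linarith
    have t2 : 2 * β * g * (η * d0) ≤ 2 * β * GM * (η * d0) := mul_le_mul_of_nonneg_right t2' hηd
    have t3 : 8 * β * GM * η * d0 ≤ 1 * d0 := mul_le_mul_of_nonneg_right P4 hd0
    linarith
  -- (d) the damping cross term through `C(Ku)`: 2βq ≤ d0/4 + (α/2) dK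
  have hcoef : 2 * β ^ 2 * CJ / α ≤ 1 / 4 := by rw [div_le_iff₀ hα]; linarith
  have hcoefd : 2 * β ^ 2 * CJ / α * d0 ≤ 1 / 4 * d0 := mul_le_mul_of_nonneg_right hcoef hd0
  have hd : 2 * β * q ≤ d0 / 4 + α / 2 * dK := by
    have hinv : (2 * β * CJ / α)⁻¹ = α / (2 * β * CJ) := by rw [inv_div]
    rw [hinv] at yq
    have t0 := mul_le_mul_of_nonneg_left yq hβ.le
    have t1 : β * ((α / (2 * β * CJ)) * dCK) ≤ β * ((α / (2 * β * CJ)) * (CJ * dK)) :=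
      mul_le_mul_of_nonneg_left (mul_le_mul_of_nonneg_left h2' (by positivity)) hβ.le
    have e1 : β * ((α / (2 * β * CJ)) * (CJ * dK)) = α / 2 * dK := by field_simp
    have e2 : β * ((2 * β * CJ / α) * d0) = (2 * β ^ 2 * CJ / α) * d0 := by ring
    linarith
  -- (e) the damping cross term through `Cu`: 2βp ≤ d0/4 + (α/2) dK
  have he : 2 * β * p ≤ d0 / 4 + α / 2 * dK := by
    have hinv : (α / (2 * β))⁻¹ = 2 * β / α := by rw [inv_div]
    rw [hinv] at yp
    have t0 := mul_le_mul_of_nonneg_left yp hβ.le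
    have t1 : β * ((2 * β / α) * dC) ≤ β * ((2 * β / α) * (CJ * d0)) :=
      mul_le_mul_of_nonneg_left (mul_le_mul_of_nonneg_left h2 (by positivity)) hβ.le
    have e1 : β * ((α / (2 * β)) * dK) = α / 2 * dK := by field_simp
    have e2 : β * ((2 * β / α) * (CJ * d0)) = (2 * β ^ 2 * CJ / α) * d0 := by ring
    linarith
  -- the right-hand side: (3/2)λ(n² + αk²) ≤ ¾ d0 + βGm c², and Φ ≤ (3/2)(n² + αk²)
  have hr1 : 3 / 2 * lam * (α * k ^ 2) ≤ d0 / 4 := by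
    have t : 6 * lam * α * k ^ 2 ≤ lo₁ * k ^ 2 := mul_le_mul_of_nonneg_right P5 hk2
    linarith
  have hr2 : 3 / 2 * lam * n ^ 2 ≤ d0 / 2 + β * Gm * c ^ 2 := by
    have t0 : 3 / 2 * lam * n ^ 2 ≤ 3 / 2 * lam * (U₁ * c ^ 2 + U₂ * k ^ 2 + U₃ * d0) :=
      mul_le_mul_of_nonneg_left h5 (by positivity)
    have t1 : 3 * lam * U₁ * c ^ 2 ≤ 2 * β * Gm * c ^ 2 := mul_le_mul_of_nonneg_right P8 hc2
    have t2 : 6 * lam * U₂ * k ^ 2 ≤ lo₁ * k ^ 2 := mul_le_mul_of_nonneg_right P6 hk2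
    have t3 : 6 * lam * U₃ * d0 ≤ 1 * d0 := mul_le_mul_of_nonneg_right P7 hd0
    linarith
  have hΦ : n ^ 2 + α * k ^ 2 - 2 * β * x ≤ 3 / 2 * (n ^ 2 + α * k ^ 2) := by
    -- 2β|x| ≤ (α/2)k² + ½n²
    have h1' : 2 * β * (k * c) ≤ α / 2 * k ^ 2 + 2 * β ^ 2 / α * c ^ 2 := by
      have e : α / 2 * k ^ 2 + 2 * β ^ 2 / α * c ^ 2 - 2 * β * (k * c) = (α * k - 2 * β * c) ^ 2 / (2 * α) := by
        field_simp; ring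
      have : 0 ≤ (α * k - 2 * β * c) ^ 2 / (2 * α) := div_nonneg (sq_nonneg _) (by linarith)
      linarith
    have h2'' : 2 * β ^ 2 / α * c ^ 2 ≤ 1 / 2 * n ^ 2 := by
      have t : 2 * β ^ 2 / α * c ^ 2 ≤ 2 * β ^ 2 / α * (A * n ^ 2) := mul_le_mul_of_nonneg_left h3 (by positivity)
      have hcoef' : 2 * β ^ 2 / α * A ≤ 1 / 2 := by rw [div_mul_eq_mul_div, div_le_iff₀ hα]; linarith
      have t' : 2 * β ^ 2 / α * A * n ^ 2 ≤ 1 / 2 * n ^ 2 := mul_le_mul_of_nonneg_right hcoef' (by positivity)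
      linarith
    have t : 2 * β * (-x) ≤ 2 * β * (k * c) := mul_le_mul_of_nonneg_left hxge (by positivity)
    linarith
  have hfin : lam * (n ^ 2 + α * k ^ 2 - 2 * β * x) ≤ lam * (3 / 2 * (n ^ 2 + α * k ^ 2)) :=
    mul_le_mul_of_nonneg_left hΦ hlam
  have hαdK : 0 ≤ α * dK := mul_nonneg hα.le hdK
  linarith

/-! ## §5 The pointwise dissipation inequality -/

/-- **Pointwise dissipation inequality.**  For `u ∈ V`, `g ∈ [Gm,GM]` and the velocity `w = g•Bu − Du`, the derivative of `Φ` along `w`,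
`2⟪u,w⟫ + 2α⟪Ku,Kw⟫ − 2β(⟪Ku,Cw⟫ + ⟪Kw,Cu⟫)`, is `≤ −λ·Φ(u)` under (P1)–(P8).  Proof: the commutator identities turn it into
`−2⟪Du,u⟫ + 2αg⟪Ku,Cu⟫ − 2α⟪DKu,Ku⟫ − 2βg‖Cu‖² − 2βg⟪Ku,[C,B]u⟫ + 2β⟪Du,CKu⟫ + 2β⟪DKu,Cu⟫` and `scalar_core` bounds it.
[cite: BedrossianCotiZelati2017, §2 (proof of the hypocoercivity estimate)] [cite: Villani2009, Part I §2] -/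
theorem dissipation_pointwise (V : Submodule ℝ F) (K B C D : F →L[ℝ] F)
    (hK : ∀ u v, ⟪K u, v⟫_ℝ = ⟪u, K v⟫_ℝ) (hB : ∀ u v, ⟪B u, v⟫_ℝ = -⟪u, B v⟫_ℝ) (hC : ∀ u, C u = K (B u) - B (K u))
    (hDs : ∀ u v, ⟪D u, v⟫_ℝ = ⟪u, D v⟫_ℝ) (hDp : ∀ u, 0 ≤ ⟪D u, u⟫_ℝ) (hKD : ∀ u, K (D u) = D (K u)) (hVK : ∀ u ∈ V, K u ∈ V)
    {Gm GM lo₁ CJ A η U₁ U₂ U₃ α β lam : ℝ} (hGm : 0 ≤ Gm) (hlo₁ : 0 < lo₁) (hCJ : 0 < CJ) (hη : 0 ≤ η)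
    (hα : 0 < α) (hβ : 0 < β) (hlam : 0 ≤ lam)
    (h1 : ∀ u ∈ V, lo₁ * ‖K u‖ ^ 2 ≤ ⟪D u, u⟫_ℝ) (h2 : ∀ u ∈ V, ⟪D (C u), C u⟫_ℝ ≤ CJ * ⟪D u, u⟫_ℝ)
    (h3 : ∀ u ∈ V, ‖C u‖ ^ 2 ≤ A * ‖u‖ ^ 2) (h4 : ∀ u ∈ V, -(η * ⟪D u, u⟫_ℝ) ≤ ⟪K u, C (B u) - B (C u)⟫_ℝ)
    (h5 : ∀ u ∈ V, ‖u‖ ^ 2 ≤ U₁ * ‖C u‖ ^ 2 + U₂ * ‖K u‖ ^ 2 + U₃ * ⟪D u, u⟫_ℝ)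
    (P1 : 4 * A * β ^ 2 ≤ α) (P2 : 8 * CJ * β ^ 2 ≤ α) (P3 : 2 * α ^ 2 * GM ^ 2 ≤ β * Gm * lo₁) (P4 : 8 * β * GM * η ≤ 1)
    (P5 : 6 * lam * α ≤ lo₁) (P6 : 6 * lam * U₂ ≤ lo₁) (P7 : 6 * lam * U₃ ≤ 1) (P8 : 3 * lam * U₁ ≤ 2 * β * Gm)
    {u : F} (hu : u ∈ V) {g : ℝ} (hg : Gm ≤ g ∧ g ≤ GM) :
    2 * ⟪u, g • B u - D u⟫_ℝ + α * (2 * ⟪K u, K (g • B u - D u)⟫_ℝ)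
        - 2 * β * (⟪K u, C (g • B u - D u)⟫_ℝ + ⟪K (g • B u - D u), C u⟫_ℝ)
      ≤ -(lam * (‖u‖ ^ 2 + α * ‖K u‖ ^ 2 - 2 * β * ⟪K u, C u⟫_ℝ)) := by
  have hCs : ∀ a b : F, ⟪C a, b⟫_ℝ = ⟪a, C b⟫_ℝ := comm_symm K B C hK hB hC
  have hKB : K (B u) = C u + B (K u) := by rw [hC u]; abel
  -- the four inner products of the velocity
  have e0 : ⟪u, g • B u - D u⟫_ℝ = -⟪D u, u⟫_ℝ := by
    rw [inner_sub_right, real_inner_smul_right, ← real_inner_comm u (B u), skew_inner_self B hB u, mul_zero, zero_sub,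
      real_inner_comm (D u) u]
  have e1 : ⟪K u, K (g • B u - D u)⟫_ℝ = g * ⟪K u, C u⟫_ℝ - ⟪D (K u), K u⟫_ℝ := by
    rw [map_sub, map_smul, hKB, hKD, inner_sub_right, real_inner_smul_right, inner_add_right,
      ← real_inner_comm (K u) (B (K u)), skew_inner_self B hB (K u), add_zero, real_inner_comm (D (K u)) (K u)]
  have e2 : ⟪K u, C (g • B u - D u)⟫_ℝ = g * ⟪K u, C (B u)⟫_ℝ - ⟪D u, C (K u)⟫_ℝ := by
    rw [map_sub, map_smul, inner_sub_right, real_inner_smul_right, ← hCs (K u) (D u), real_inner_comm (D u) (C (K u))]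
  have e3 : ⟪K (g • B u - D u), C u⟫_ℝ = g * (‖C u‖ ^ 2 - ⟪K u, B (C u)⟫_ℝ) - ⟪D (K u), C u⟫_ℝ := by
    rw [map_sub, map_smul, hKB, hKD, inner_sub_left, real_inner_smul_left, inner_add_left, real_inner_self_eq_norm_sq,
      hB (K u) (C u)]
    ring
  have em : ⟪K u, C (B u)⟫_ℝ - ⟪K u, B (C u)⟫_ℝ = ⟪K u, C (B u) - B (C u)⟫_ℝ := by rw [inner_sub_right]
  have lhs : 2 * ⟪u, g • B u - D u⟫_ℝ + α * (2 * ⟪K u, K (g • B u - D u)⟫_ℝ)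
        - 2 * β * (⟪K u, C (g • B u - D u)⟫_ℝ + ⟪K (g • B u - D u), C u⟫_ℝ)
      = -2 * ⟪D u, u⟫_ℝ + 2 * α * g * ⟪K u, C u⟫_ℝ - 2 * α * ⟪D (K u), K u⟫_ℝ - 2 * β * g * ‖C u‖ ^ 2
        - 2 * β * g * ⟪K u, C (B u) - B (C u)⟫_ℝ + 2 * β * ⟪D u, C (K u)⟫_ℝ + 2 * β * ⟪D (K u), C u⟫_ℝ := by
    rw [e0, e1, e2, e3, ← em]; ring
  rw [lhs]
  have hKu : K u ∈ V := hVK u hu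
  exact scalar_core (norm_nonneg (K u)) (norm_nonneg (C u)) (hDp u) (hDp (K u)) hGm hg hlo₁ hCJ hη hα hβ hlam
    (h1 u hu) (h2 u hu) (h2 (K u) hKu) (h3 u hu) (h4 u hu) (h5 u hu) (abs_real_inner_le_norm _ _)
    (young_form D hDs hDp (by positivity) u (C (K u))) (young_form D hDs hDp (by positivity) (K u) (C u))
    P1 P2 P3 P4 P5 P6 P7 P8

/-! ## §6 The decay theorem -/

/-- Derivative of the functional along a differentiable curve. [cite: BedrossianCotiZelati2017, §2] -/
theorem hasDerivAt_functional (K C : F →L[ℝ] F) (α β : ℝ) {y : ℝ → F} {y' : F} {t : ℝ} (hy : HasDerivAt y y' t) :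
    HasDerivAt (fun s => ‖y s‖ ^ 2 + α * ‖K (y s)‖ ^ 2 - 2 * β * ⟪K (y s), C (y s)⟫_ℝ)
      (2 * ⟪y t, y'⟫_ℝ + α * (2 * ⟪K (y t), K y'⟫_ℝ) - 2 * β * (⟪K (y t), C y'⟫_ℝ + ⟪K y', C (y t)⟫_ℝ)) t := by
  have hK : HasDerivAt (fun s => K (y s)) (K y') t := K.hasFDerivAt.comp_hasDerivAt t hy
  have hC : HasDerivAt (fun s => C (y s)) (C y') t := C.hasFDerivAt.comp_hasDerivAt t hy
  have h0 : HasDerivAt (fun s => ‖y s‖ ^ 2) (2 * ⟪y t, y'⟫_ℝ) t := hy.norm_sq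
  have h1 : HasDerivAt (fun s => ‖K (y s)‖ ^ 2) (2 * ⟪K (y t), K y'⟫_ℝ) t := hK.norm_sq
  have h2 : HasDerivAt (fun s => ⟪K (y s), C (y s)⟫_ℝ) (⟪K (y t), C y'⟫_ℝ + ⟪K y', C (y t)⟫_ℝ) t := hK.inner ℝ hC
  have h := (h0.fun_add (h1.const_mul α)).fun_sub (h2.const_mul (2 * β))
  exact h

/-- **THE THREE-TERM HYPOCOERCIVE DECAY LEMMA.**  Under the hypotheses of the module docstring and the constraints (P1)–(P8):
`‖y t₁‖² ≤ 3·exp(−λ(t₁−t₀))·(‖y t₀‖² + α‖K(y t₀)‖²)`.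
[cite: BedrossianCotiZelati2017, §2 (hypocoercivity functional, enhanced dissipation)] [cite: Villani2009, Part I §2 (A*A + B)] -/
theorem hypocoercive_decay (V : Submodule ℝ F) (K B C : F →L[ℝ] F) (D : ℝ → (F →L[ℝ] F)) (G : ℝ → ℝ) (y : ℝ → F)
    {t₀ t₁ : ℝ} (ht : t₀ ≤ t₁)
    (hK : ∀ u v, ⟪K u, v⟫_ℝ = ⟪u, K v⟫_ℝ) (hB : ∀ u v, ⟪B u, v⟫_ℝ = -⟪u, B v⟫_ℝ) (hC : ∀ u, C u = K (B u) - B (K u))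
    (hDs : ∀ t u v, ⟪D t u, v⟫_ℝ = ⟪u, D t v⟫_ℝ) (hDp : ∀ t u, 0 ≤ ⟪D t u, u⟫_ℝ) (hKD : ∀ t u, K (D t u) = D t (K u))
    (hVK : ∀ u ∈ V, K u ∈ V)
    (hyV : ∀ t ∈ Icc t₀ t₁, y t ∈ V) (hy : ∀ t ∈ Icc t₀ t₁, HasDerivAt y (G t • B (y t) - D t (y t)) t)
    {Gm GM lo₁ CJ A η U₁ U₂ U₃ α β lam : ℝ} (hG : ∀ t ∈ Icc t₀ t₁, Gm ≤ G t ∧ G t ≤ GM)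
    (hGm : 0 ≤ Gm) (hlo₁ : 0 < lo₁) (hCJ : 0 < CJ) (hη : 0 ≤ η) (hα : 0 < α) (hβ : 0 < β) (hlam : 0 ≤ lam)
    (h1 : ∀ t ∈ Icc t₀ t₁, ∀ u ∈ V, lo₁ * ‖K u‖ ^ 2 ≤ ⟪D t u, u⟫_ℝ)
    (h2 : ∀ t ∈ Icc t₀ t₁, ∀ u ∈ V, ⟪D t (C u), C u⟫_ℝ ≤ CJ * ⟪D t u, u⟫_ℝ)
    (h3 : ∀ u ∈ V, ‖C u‖ ^ 2 ≤ A * ‖u‖ ^ 2)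
    (h4 : ∀ t ∈ Icc t₀ t₁, ∀ u ∈ V, -(η * ⟪D t u, u⟫_ℝ) ≤ ⟪K u, C (B u) - B (C u)⟫_ℝ)
    (h5 : ∀ t ∈ Icc t₀ t₁, ∀ u ∈ V, ‖u‖ ^ 2 ≤ U₁ * ‖C u‖ ^ 2 + U₂ * ‖K u‖ ^ 2 + U₃ * ⟪D t u, u⟫_ℝ)
    (P1 : 4 * A * β ^ 2 ≤ α) (P2 : 8 * CJ * β ^ 2 ≤ α) (P3 : 2 * α ^ 2 * GM ^ 2 ≤ β * Gm * lo₁) (P4 : 8 * β * GM * η ≤ 1)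
    (P5 : 6 * lam * α ≤ lo₁) (P6 : 6 * lam * U₂ ≤ lo₁) (P7 : 6 * lam * U₃ ≤ 1) (P8 : 3 * lam * U₁ ≤ 2 * β * Gm) :
    ‖y t₁‖ ^ 2 ≤ 3 * Real.exp (-(lam * (t₁ - t₀))) * (‖y t₀‖ ^ 2 + α * ‖K (y t₀)‖ ^ 2) := by
  set Φ : ℝ → ℝ := fun s => ‖y s‖ ^ 2 + α * ‖K (y s)‖ ^ 2 - 2 * β * ⟪K (y s), C (y s)⟫_ℝ with hΦ
  -- derivative of Φ and the differential inequality
  have hΦd : ∀ t ∈ Icc t₀ t₁, HasDerivAt Φ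
      (2 * ⟪y t, G t • B (y t) - D t (y t)⟫_ℝ + α * (2 * ⟪K (y t), K (G t • B (y t) - D t (y t))⟫_ℝ)
        - 2 * β * (⟪K (y t), C (G t • B (y t) - D t (y t))⟫_ℝ + ⟪K (G t • B (y t) - D t (y t)), C (y t)⟫_ℝ)) t :=
    fun t ht => hasDerivAt_functional K C α β (hy t ht)
  have hΦle : ∀ t ∈ Icc t₀ t₁,
      2 * ⟪y t, G t • B (y t) - D t (y t)⟫_ℝ + α * (2 * ⟪K (y t), K (G t • B (y t) - D t (y t))⟫_ℝ)
        - 2 * β * (⟪K (y t), C (G t • B (y t) - D t (y t))⟫_ℝ + ⟪K (G t • B (y t) - D t (y t)), C (y t)⟫_ℝ)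
      ≤ -(lam * Φ t) := fun t ht =>
    dissipation_pointwise V K B C (D t) hK hB hC (hDs t) (hDp t) (hKD t) hVK hGm hlo₁ hCJ hη hα hβ hlam
      (h1 t ht) (h2 t ht) h3 (h4 t ht) (h5 t ht) P1 P2 P3 P4 P5 P6 P7 P8 (hyV t ht) (hG t ht)
  -- ψ = e^{λ t} Φ is antitone
  set ψ : ℝ → ℝ := fun s => Real.exp (lam * s) * Φ s with hψ
  have hψd : ∀ t ∈ Icc t₀ t₁, HasDerivAt ψ (Real.exp (lam * t) * lam * Φ t + Real.exp (lam * t) *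
      (2 * ⟪y t, G t • B (y t) - D t (y t)⟫_ℝ + α * (2 * ⟪K (y t), K (G t • B (y t) - D t (y t))⟫_ℝ)
        - 2 * β * (⟪K (y t), C (G t • B (y t) - D t (y t))⟫_ℝ + ⟪K (G t • B (y t) - D t (y t)), C (y t)⟫_ℝ))) t := by
    intro t ht
    have h1' : HasDerivAt (fun s => Real.exp (lam * s)) (Real.exp (lam * t) * lam) t := by
      simpa using ((hasDerivAt_id t).const_mul lam).exp
    exact h1'.mul (hΦd t ht)
  have hanti : AntitoneOn ψ (Icc t₀ t₁) := by
    refine antitoneOn_of_deriv_nonpos (convex_Icc t₀ t₁) ?_ ?_ ?_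
    · exact fun t ht => (hψd t ht).continuousAt.continuousWithinAt
    · intro t ht
      rw [interior_Icc] at ht
      exact (hψd t ⟨ht.1.le, ht.2.le⟩).differentiableAt.differentiableWithinAt
    · intro t ht
      rw [interior_Icc] at ht
      rw [(hψd t ⟨ht.1.le, ht.2.le⟩).deriv]
      have hle := hΦle t ⟨ht.1.le, ht.2.le⟩
      have he : 0 < Real.exp (lam * t) := Real.exp_pos _
      nlinarith
  have hmono := hanti (left_mem_Icc.2 ht) (right_mem_Icc.2 ht) ht
  -- unwind: Φ t₁ ≤ e^{-λ(t₁-t₀)} Φ t₀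
  have h3' : ∀ t ∈ Icc t₀ t₁, ‖C (y t)‖ ^ 2 ≤ A * ‖y t‖ ^ 2 := fun t ht => h3 (y t) (hyV t ht)
  have hlow : 1 / 2 * (‖y t₁‖ ^ 2 + α * ‖K (y t₁)‖ ^ 2) ≤ Φ t₁ :=
    functional_ge K C hα hβ.le P1 (y t₁) (h3' t₁ (right_mem_Icc.2 ht))
  have hup : Φ t₀ ≤ 3 / 2 * (‖y t₀‖ ^ 2 + α * ‖K (y t₀)‖ ^ 2) :=
    functional_le K C hα hβ.le P1 (y t₀) (h3' t₀ (left_mem_Icc.2 ht))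
  have hexp : Real.exp (lam * t₁) * Φ t₁ ≤ Real.exp (lam * t₀) * Φ t₀ := by simpa [hψ] using hmono
  have he1 : 0 < Real.exp (lam * t₁) := Real.exp_pos _
  have hΦ1 : Φ t₁ ≤ Real.exp (-(lam * (t₁ - t₀))) * Φ t₀ := by
    have hmul := mul_le_mul_of_nonneg_left hexp (Real.exp_pos (-(lam * t₁))).le
    have e1 : Real.exp (-(lam * t₁)) * (Real.exp (lam * t₁) * Φ t₁) = Φ t₁ := by
      rw [← mul_assoc, ← Real.exp_add]; simp
    have e2 : Real.exp (-(lam * t₁)) * (Real.exp (lam * t₀) * Φ t₀) = Real.exp (-(lam * (t₁ - t₀))) * Φ t₀ := by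
      rw [← mul_assoc, ← Real.exp_add]; congr 1; ring_nf
    rw [e1, e2] at hmul
    exact hmul
  have hK0 : 0 ≤ α * ‖K (y t₁)‖ ^ 2 := by positivity
  have hE : 0 ≤ Real.exp (-(lam * (t₁ - t₀))) := (Real.exp_pos _).le
  have : Real.exp (-(lam * (t₁ - t₀))) * Φ t₀ ≤ Real.exp (-(lam * (t₁ - t₀))) * (3 / 2 * (‖y t₀‖ ^ 2 + α * ‖K (y t₀)‖ ^ 2)) :=
    mul_le_mul_of_nonneg_left hup hE
  nlinarith

end

end Summit.AnomalousDissipation.AnomalousDissipation.Theorems.SolenoidalFractalHomogenisation.LagrangianStep.LadderCrush
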